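import Summits.Ventures.DiscreteObjects.PP12.FanoFiveSignGram

/-!
# PP(12), order 5: the pair identities `2RRᵀ + EEᵀ = 24I + 3J`, `2RᵀR + E*E*ᵀ = 24I + 3J`, `RE* = −EM`, `RᵀE = −E*Mᵀ` from a typed orbit matrix (kernel)
Framing: lottery ticket; floor = certified bounds/negative ranges.

Cell pub-namedobj (venture DiscreteObjects), target (M), designs gen 17 (p = 5 identification, designs g16 HANDOFF item (c)); continues
`FanoFiveSignGram`. For `IsFanoFiveIncMatrix I M` and the read-off data `sgnM / eps / epsStar / rr` (`FanoFiveSignSystem`):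
* `gram_rr_rows`: `2 Σ_N R_{ON} R_{O'N} + Σ_x ε_x(O) ε_x(O') = 27·[O = O'] + 3·[O ≠ O']` — the complete COLUMN inner product of the exterior point
  orbits `O, O'` (`17 / 5`) split over tangent rows (`2 Σ_a M (x,a) O · M (x,a) O' = 1 + ε_x(O) ε_x(O')`) and exterior rows (FAMILY-P5PLANE §2 (a), (b));
* `gram_rr_cols`: the dual, from the complete ROW inner product of two exterior line orbits;
* `mixed_rows`: `Σ_N R_{ON} ε*_μ(N) = − Σ_x ε_x(O) m(x, μ)` — the two column inner products `(μ,0)·O` and `(μ,1)·O` are both `5`, their difference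
  splits into `Σ_x m(x,μ) ε_x(O)` (tangent rows) and `(RE*)_{Oμ}` (exterior rows) (FAMILY-P5PLANE §2 (d));
* `mixed_cols`: the dual;
* `eps_rows_ne`, `epsStar_rows_ne`: rows of `E` (`E*`) are pairwise distinct (`⟨E_O, E_O'⟩ = 7` would force `Σ R R' < 0`).
Nothing here asserts any census statement. No `sorry`, no new axioms.
-/

namespace Summit.Ventures.DiscreteObjects.PP12

open Finset

namespace IsFanoFiveIncMatrix

open FanoFive

variable {I : Fin 7 → Fin 7 → Bool} {M : F5Idx → F5Idx → ℕ}

/-- the tangent part of the column inner product of two exterior point orbits: `2 Σ_x Σ_a M (x,a) O · M (x,a) O' = 7 + ⟨E_O, E_O'⟩` -/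
theorem two_mul_tangent_col_inner (h : IsFanoFiveIncMatrix I M) (O O' : Fin 16) :
    2 * ∑ x : Fin 7, ∑ a : Fin 2, (M (Sum.inl (x, a)) (Sum.inr O) : ℤ) * (M (Sum.inl (x, a)) (Sum.inr O') : ℤ) =
      7 + ∑ x : Fin 7, eps M O x * eps M O' x := by
  rw [Finset.mul_sum]
  simp_rw [two_mul_att_prod h]
  rw [Finset.sum_add_distrib]
  simp

/-- the tangent part of the row inner product of two exterior line orbits: `2 Σ_μ Σ_b M N (μ,b) · M N' (μ,b) = 7 + ⟨E*_N, E*_N'⟩` -/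
theorem two_mul_tangent_row_inner (h : IsFanoFiveIncMatrix I M) (N N' : Fin 16) :
    2 * ∑ μ : Fin 7, ∑ b : Fin 2, (M (Sum.inr N) (Sum.inl (μ, b)) : ℤ) * (M (Sum.inr N') (Sum.inl (μ, b)) : ℤ) =
      7 + ∑ μ : Fin 7, epsStar M N μ * epsStar M N' μ := by
  rw [Finset.mul_sum]
  simp_rw [two_mul_attStar_prod h]
  rw [Finset.sum_add_distrib]
  simp

/-- the target of two exterior indices, cast to `ℤ` -/
theorem target_exterior_cast (e e' : Fin 16) :
    (FanoFive.target (Sum.inr e) (Sum.inr e') : ℤ) = if e = e' then 17 else 5 := by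
  by_cases he : e = e' <;> simp [FanoFive.target, he]

/-- **`2 R Rᵀ + E Eᵀ = 24 I + 3 J`** -/
theorem gram_rr_rows (h : IsFanoFiveIncMatrix I M) (O O' : Fin 16) :
    2 * ∑ N : Fin 16, rr M O N * rr M O' N + ∑ x : Fin 7, eps M O x * eps M O' x = if O = O' then 27 else 3 := by
  have hc := col_inner_cast h (Sum.inr O) (Sum.inr O')
  rw [Fintype.sum_sum_type, Fintype.sum_prod_type, target_exterior_cast] at hc
  have ht := two_mul_tangent_col_inner h O O'
  unfold rr
  split_ifs at hc ⊢ <;> linarith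

/-- **`2 Rᵀ R + E* E*ᵀ = 24 I + 3 J`** -/
theorem gram_rr_cols (h : IsFanoFiveIncMatrix I M) (N N' : Fin 16) :
    2 * ∑ O : Fin 16, rr M O N * rr M O N' + ∑ μ : Fin 7, epsStar M N μ * epsStar M N' μ = if N = N' then 27 else 3 := by
  have hr := row_inner_cast h (Sum.inr N) (Sum.inr N')
  rw [Fintype.sum_sum_type, Fintype.sum_prod_type, target_exterior_cast] at hr
  have ht := two_mul_tangent_row_inner h N N'
  unfold rr
  split_ifs at hr ⊢ <;> linarith

/-- the target of a tangent index against an exterior index is `5` -/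
theorem target_inl_inr_cast (xa : Fin 7 × Fin 2) (e : Fin 16) : (FanoFive.target (Sum.inl xa) (Sum.inr e) : ℤ) = 5 := by
  rcases xa with ⟨x, a⟩
  simp [FanoFive.target]

/-- **`R E* = − E M`** -/
theorem mixed_rows (h : IsFanoFiveIncMatrix I M) (O : Fin 16) (μ : Fin 7) :
    ∑ N : Fin 16, rr M O N * epsStar M N μ = -∑ x : Fin 7, eps M O x * sgnM M x μ := by
  have h0 := col_inner_cast h (Sum.inl (μ, 0)) (Sum.inr O)
  have h1 := col_inner_cast h (Sum.inl (μ, 1)) (Sum.inr O)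
  rw [target_inl_inr_cast] at h0 h1
  have hd : ∑ r : F5Idx, ((M r (Sum.inl (μ, 0)) : ℤ) - (M r (Sum.inl (μ, 1)) : ℤ)) * (M r (Sum.inr O) : ℤ) = 0 := by
    rw [sum_sub_mul, h0, h1]; ring
  rw [Fintype.sum_sum_type, Fintype.sum_prod_type] at hd
  have ht : ∑ x : Fin 7, ∑ a : Fin 2, ((M (Sum.inl (x, a)) (Sum.inl (μ, 0)) : ℤ) - (M (Sum.inl (x, a)) (Sum.inl (μ, 1)) : ℤ)) *
      (M (Sum.inl (x, a)) (Sum.inr O) : ℤ) = ∑ x : Fin 7, eps M O x * sgnM M x μ :=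
    Finset.sum_congr rfl fun x _ => by rw [sum_coldiff_mul_att h x μ O, mul_comm]
  have he : ∑ N : Fin 16, ((M (Sum.inr N) (Sum.inl (μ, 0)) : ℤ) - (M (Sum.inr N) (Sum.inl (μ, 1)) : ℤ)) *
      (M (Sum.inr N) (Sum.inr O) : ℤ) = ∑ N : Fin 16, rr M O N * epsStar M N μ :=
    Finset.sum_congr rfl fun N _ => by unfold rr epsStar; ring
  rw [ht, he] at hd
  linarith

/-- **`Rᵀ E = − E* Mᵀ`** -/
theorem mixed_cols (h : IsFanoFiveIncMatrix I M) (N : Fin 16) (x : Fin 7) :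
    ∑ O : Fin 16, rr M O N * eps M O x = -∑ μ : Fin 7, epsStar M N μ * sgnM M x μ := by
  have h0 := row_inner_cast h (Sum.inl (x, 0)) (Sum.inr N)
  have h1 := row_inner_cast h (Sum.inl (x, 1)) (Sum.inr N)
  rw [target_inl_inr_cast] at h0 h1
  have hd : ∑ c : F5Idx, ((M (Sum.inl (x, 0)) c : ℤ) - (M (Sum.inl (x, 1)) c : ℤ)) * (M (Sum.inr N) c : ℤ) = 0 := by
    rw [sum_sub_mul, h0, h1]; ring
  rw [Fintype.sum_sum_type, Fintype.sum_prod_type] at hd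
  have ht : ∑ μ : Fin 7, ∑ b : Fin 2, ((M (Sum.inl (x, 0)) (Sum.inl (μ, b)) : ℤ) - (M (Sum.inl (x, 1)) (Sum.inl (μ, b)) : ℤ)) *
      (M (Sum.inr N) (Sum.inl (μ, b)) : ℤ) = ∑ μ : Fin 7, epsStar M N μ * sgnM M x μ :=
    Finset.sum_congr rfl fun μ _ => by rw [sum_rowdiff_mul_attStar h x μ N, mul_comm]
  have he : ∑ O : Fin 16, ((M (Sum.inl (x, 0)) (Sum.inr O) : ℤ) - (M (Sum.inl (x, 1)) (Sum.inr O) : ℤ)) *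
      (M (Sum.inr N) (Sum.inr O) : ℤ) = ∑ O : Fin 16, rr M O N * eps M O x :=
    Finset.sum_congr rfl fun O _ => by unfold rr eps; ring
  rw [ht, he] at hd
  linarith

/-- a sign vector has norm `7` -/
theorem sum_sign_sq {v : Fin 7 → ℤ} (hv : ∀ x, v x = 1 ∨ v x = -1) : ∑ x : Fin 7, v x * v x = 7 := by
  have : ∀ x, v x * v x = 1 := fun x => by rcases hv x with h | h <;> rw [h] <;> ring
  simp_rw [this]
  simp

/-- the exterior Gram term is non-negative -/
theorem sum_rr_mul_rr_nonneg (M : F5Idx → F5Idx → ℕ) (O O' : Fin 16) : 0 ≤ ∑ N : Fin 16, rr M O N * rr M O' N :=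
  Finset.sum_nonneg fun N _ => mul_nonneg (rr_nonneg M O N) (rr_nonneg M O' N)

/-- the exterior Gram term is non-negative (columns) -/
theorem sum_rr_mul_rr_nonneg_col (M : F5Idx → F5Idx → ℕ) (N N' : Fin 16) : 0 ≤ ∑ O : Fin 16, rr M O N * rr M O N' :=
  Finset.sum_nonneg fun O _ => mul_nonneg (rr_nonneg M O N) (rr_nonneg M O N')

/-- **rows of `E` are pairwise distinct** -/
theorem eps_rows_ne (h : IsFanoFiveIncMatrix I M) {O O' : Fin 16} (hne : O ≠ O') : eps M O ≠ eps M O' := by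
  intro heq
  have hg := gram_rr_rows h O O'
  rw [if_neg hne, heq, sum_sign_sq (eps_sign h O')] at hg
  have := sum_rr_mul_rr_nonneg M O O'
  linarith

/-- **rows of `E*` are pairwise distinct** -/
theorem epsStar_rows_ne (h : IsFanoFiveIncMatrix I M) {N N' : Fin 16} (hne : N ≠ N') : epsStar M N ≠ epsStar M N' := by
  intro heq
  have hg := gram_rr_cols h N N'
  rw [if_neg hne, heq, sum_sign_sq (epsStar_sign h N')] at hg
  have := sum_rr_mul_rr_nonneg_col M N N'
  linarith

end IsFanoFiveIncMatrix

end Summit.Ventures.DiscreteObjects.PP12
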